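import Summits.QuantumFields.YangMills.Theorems.UnitScaleTiltProp8FlatCubeSequence
import Summits.QuantumFields.YangMills.Theorems.UnitScaleTiltProp8FlatCubeLevels
import HarnessLib

/-!
# Route `UnitScaleTilt`, crux K1 child «MinimiserStabilityRegPr» (stmt-QuantumFields-19200), leaf V2′ `stub_halvingStep` — PILLAR F3′
# (k-LEVEL FLAT OPERATORS ON THE CUBE SEQUENCE, UV3-NODE §24), FILE 4: **THE LEVEL MAP OF THE CUBE SEQUENCE (144)** — `levOf (cubeSet x₀ k ρ S) k x`
# (the F4 pen's weight level, lit-balaban `B11Eq115Space.levOf`) `= j` iff the `j`-block of `x` lies in the annulus `Λ′_j` of the nested family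
# `cubeSeq x₀ k hk ρ S` ([Balaban1984PropagatorsII] (2.3)–(2.4)); explicitly: `= k` on `□_k`, `= j` on `□_j ∖ □_{j+1}`, `= 0` off `□₁` (the frozen exterior)

Cell `ym3-torus` (HUMAN RULING D-0037, YM ladder rung R3), seat `ym3-torus-p1` gen 15.  `--supports stmt-QuantumFields-19200 --as helper`; count-neutral;
def-free; instance of file 3 (`FlatCubeLevels`, general `D`) at file 1's `cubeSeq`/`cubeSet` (p527555) through `FlatCubeSequence.inOm_cubeSeq_iff`.

WHAT IS PROVED (sorry-free; axioms standard): `levOf_cubeSet_eq_iff_lamSite`, `lamSite_levOf_cubeSet`, `levOf_cubeSet_eq_top_iff` (`j(x) = k ↔ x ∈ □_k`),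
`levOf_cubeSet_eq_zero_iff` (`j(x) = 0 ↔ x ∉ □₁`), `levOf_cubeSet_eq_iff_mem_diff` (`1 ≤ j < k`: `j(x) = j ↔ x ∈ □_j ∖ □_{j+1}`), and the d = 3 forms for
`cubeSeqT3`.  HONEST SCOPE: bookkeeping; NOT a claim about the mass gap.

References: [Balaban1985Variational] (144) p.300, p.286; [Balaban1984PropagatorsII] (2.3)–(2.4) p.224.
-/

set_option autoImplicit false

namespace Summit.QuantumFields.YangMills.Theorems.FlatCubeSequenceLevels

open Literature.MathematicalPhysics.QuantumFieldTheory.Balaban1983to89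
open B6SectADomainsV1 (Domains)
open B5Eq118OneStroke (iterBlockOf)
open B11Eq115Space (levOf)
open FlatCubeSequence (cubeSeq cubeSet cubeSeqT3 inOm_cubeSeq_iff cubeSet_of_lt mem_cubeSet_iff)
open FlatCubeLevels (levOf_eq_iff_lamSite_of_agree)

variable {P : Params}

/-- `cubeSet` reads `cubeSeq` at the positive levels (and is empty beyond `k`). [cite: Balaban1985Variational, (144) p.300] -/
theorem cubeSet_agree (x₀ : Site P 0) {k : ℕ} (hk : k ≤ P.m + P.K) (ρ S : ℕ) (x : Site P 0) :
    ∀ j, 1 ≤ j → j ≤ (cubeSeq x₀ k hk ρ S).k → (x ∈ cubeSet x₀ k ρ S j ↔ (cubeSeq x₀ k hk ρ S).InOm j x) :=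
  fun _ hj hjk => (inOm_cubeSeq_iff hk hj hjk x).symm

/-- **THE WEIGHT LEVEL OF THE CUBE SEQUENCE IS THE ANNULUS INDEX**: `levOf (cubeSet x₀ k ρ S) k x = j ↔` the `j`-block of `x` lies in `Λ′_j` of `cubeSeq`.
[cite: Balaban1985Variational, (144) p.300, p.286; Balaban1984PropagatorsII, (2.3)-(2.4) p.224] -/
theorem levOf_cubeSet_eq_iff_lamSite (x₀ : Site P 0) {k : ℕ} (hk : k ≤ P.m + P.K) (ρ S : ℕ) (x : Site P 0) (j : ℕ) :
    levOf (cubeSet x₀ k ρ S) k x = j ↔ (cubeSeq x₀ k hk ρ S).LamSite j (iterBlockOf j x) :=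
  levOf_eq_iff_lamSite_of_agree (cubeSeq x₀ k hk ρ S) (cubeSet_agree x₀ hk ρ S x) j

/-- every fine site lies over the annulus of its level. [cite: Balaban1984PropagatorsII, (2.4) p.224] -/
theorem lamSite_levOf_cubeSet (x₀ : Site P 0) {k : ℕ} (hk : k ≤ P.m + P.K) (ρ S : ℕ) (x : Site P 0) :
    (cubeSeq x₀ k hk ρ S).LamSite (levOf (cubeSet x₀ k ρ S) k x) (iterBlockOf (levOf (cubeSet x₀ k ρ S) k x) x) :=
  (levOf_cubeSet_eq_iff_lamSite x₀ hk ρ S x _).1 rfl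

/-- top level: `j(x) = k ↔ x ∈ □_k`. [cite: Balaban1985Variational, (144) p.300] -/
theorem levOf_cubeSet_eq_top_iff (x₀ : Site P 0) {k : ℕ} (hk1 : 1 ≤ k) (hk : k ≤ P.m + P.K) (ρ S : ℕ) (x : Site P 0) :
    levOf (cubeSet x₀ k ρ S) k x = k ↔ x ∈ cubeSet x₀ k ρ S k := by
  rw [levOf_cubeSet_eq_iff_lamSite x₀ hk ρ S x k, ← inOm_cubeSeq_iff hk hk1 le_rfl x]
  exact (cubeSeq x₀ k hk ρ S).lamSite_top_iff (iterBlockOf k x)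

/-- level zero = the frozen exterior: `j(x) = 0 ↔ x ∉ □₁` (`1 ≤ k`). [cite: Balaban1984PropagatorsII, (2.3) p.224 («Λ₀ = Ω₁ᶜ»), (2.6) p.224] -/
theorem levOf_cubeSet_eq_zero_iff (x₀ : Site P 0) {k : ℕ} (hk1 : 1 ≤ k) (hk : k ≤ P.m + P.K) (ρ S : ℕ) (x : Site P 0) :
    levOf (cubeSet x₀ k ρ S) k x = 0 ↔ x ∉ cubeSet x₀ k ρ S 1 := by
  rw [levOf_cubeSet_eq_iff_lamSite x₀ hk ρ S x 0, (cubeSeq x₀ k hk ρ S).lamSite_zero_iff, ← inOm_cubeSeq_iff hk le_rfl hk1 x]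
  exact Iff.rfl

/-- intermediate levels: for `1 ≤ j`, `j + 1 ≤ k`: `j(x) = j ↔ x ∈ □_j ∖ □_{j+1}` (the annulus `Λ′_j`). [cite: Balaban1985Variational, (144) p.300, (148) p.301] -/
theorem levOf_cubeSet_eq_iff_mem_diff (x₀ : Site P 0) {k : ℕ} (hk : k ≤ P.m + P.K) (ρ S : ℕ) (x : Site P 0) {j : ℕ} (hj : 1 ≤ j) (hjk : j + 1 ≤ k) :
    levOf (cubeSet x₀ k ρ S) k x = j ↔ x ∈ cubeSet x₀ k ρ S j ∧ x ∉ cubeSet x₀ k ρ S (j + 1) := by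
  rw [levOf_cubeSet_eq_iff_lamSite x₀ hk ρ S x j, ← inOm_cubeSeq_iff hk hj (by omega) x, ← inOm_cubeSeq_iff hk (by omega) hjk x]
  exact Iff.rfl

section T3

open T3ContinuumYM3Torus (T3Family)

/-- **AT THE d = 3 CARRIER** (`k = K − n`): the F4 pen's weight level `levOf Ω (K−n) x` for `Ω := cubeSet x₀ (K−n) ρ S` is the annulus index of
`cubeSeqT3 F n K x₀ ρ S`. [cite: Balaban1985Variational, (144) p.300, (152) p.301] -/
theorem levOf_cubeSet_T3_eq_iff (F : T3Family) (n K : ℕ) (x₀ : Site (F.P K) 0) (ρ S : ℕ) (x : Site (F.P K) 0) (j : ℕ) :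
    levOf (cubeSet x₀ (K - n) ρ S) (K - n) x = j ↔ (cubeSeqT3 F n K x₀ ρ S).LamSite j (iterBlockOf j x) :=
  levOf_cubeSet_eq_iff_lamSite x₀ (FlatMinimizerH.le_T3 F n K) ρ S x j

end T3

end Summit.QuantumFields.YangMills.Theorems.FlatCubeSequenceLevels
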